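import Mathlib
import Literature.Computability.AlgebraicComplexity.MignonRessayreBound
import Literature.RingTheory.Nullstellensatz.SkodaBrownawellDegreeBound
import Summits.ValiantsHypothesis.ValiantsHypothesis.Theses.RefutationDegree
import Summits.ValiantsHypothesis.ValiantsHypothesis.Theorems.RefutationDegreeDefs
import Summits.ValiantsHypothesis.ValiantsHypothesis.Theorems.RefutationDegreeRefutationBarrierConverse

/-!
# Crux `RefutationBarrier` (stmt-ValiantsHypothesis-5642) — round-2 ideator 5: typed first lemmas

Two NEGATION-lens crux ideas (the crux is, modulo Skoda–Brownawell, a quadratic border UPPER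
bound for per_n; round 1 + triage: no thesis-side line exists).  Both lines conclude
`¬ RefutationBarrier` through the landed `not_refutationBarrier_of_io_notInBorder` (p105398).

* Card `kernel-pair-rays-plus-one`: `mr_plus_one` — Mignon–Ressayre PLUS ONE,
  `n² + 2 ≤ 2·m` for every affine determinantal expression of per_n (n ≥ 3); hence at ODD n the
  critical system Rep(n, ⌊n²/2⌋+1) is infeasible (`not_hasDetRepr_quadSize_of_odd`), which is the
  exact-model half of the negation of the crux; the remaining half is the pure border-gap statement
  `NoGapOdd`, and `not_refutationBarrier_of_noGapOdd` is the kernel-checked composition.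
* Card `balanced-singular-limits`: `border_gap_dichotomy` + `ncFullRank_of_balanced` — a border
  point of the size-m affine determinantal image that is not an exact value is a normalised limit of
  BALANCED (Kempf–Ness) tuples spanning a SINGULAR matrix space of full non-commutative rank.
-/

noncomputable section

namespace Summit.ValiantsHypothesis.ValiantsHypothesis.Cruxes.RefutationBarrier.Ideator5

open scoped BigOperators
open Literature.Computability.AlgebraicComplexity (perPoly HasDetRepr)
open Literature.RingTheory.Nullstellensatz (skodaBrownawellDegreeBound)
open Summit.ValiantsHypothesis.ValiantsHypothesis.Theorems.RefutationDegree
open Summit.ValiantsHypothesis.ValiantsHypothesis.Theses.RefutationDegree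

/-! ## Card 1: kernel pairs are constant on rays — Mignon–Ressayre + 1 -/

/-- **First lemma of card `kernel-pair-rays-plus-one` (the theorem "MR + 1").** For `n ≥ 3`, every
affine determinantal expression `per_n = det(A₀ + Σ_e y_e A_e)` of size `m` has `n² + 2 ≤ 2m`
(Mignon–Ressayre give `n² ≤ 2m`, tree `sq_le_two_mul_of_hasDetRepr_perPoly`).  Proof (card,
§Mechanism; workfile `MRPlusOne.md`): at the two tight sizes `2m ∈ {n², n²+1}` the kernel-pair map
`κ : Z(per_n) → ℙ^{m-1} × ℙ^{m-1}` of the pencil has LINE fibres (von zur Gathen regularity +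
nondegeneracy of `Lᵀ·Hess(det)·L`), the nondegenerate Gauss map of the permanental hypersurface
(Segre's formula at the MR point) forces those lines to be the rays through `0`, so every kernel
vector lies in `ker A₀`, a line (vzG): the pencil annihilates a fixed vector, `det ≡ 0`. -/
theorem mr_plus_one {n m : ℕ} (hn : 3 ≤ n) (h : HasDetRepr (perPoly (Fin n) ℂ) m) :
    n ^ 2 + 2 ≤ 2 * m := by
  sorry

/-- Corollary: for ODD `n ≥ 3` the route's critical system Rep(n, ⌊n²/2⌋+1) is INFEASIBLE
(`⌊n²/2⌋+1 = (n²+1)/2 < (n²+3)/2 ≤ dc(per_n)`).  This is the exact-model half of `¬ RefutationBarrier`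
(`¬crux ⟹ dc(per_n) ≥ ⌊n²/2⌋+2` i.o., by `SosSound`), open before `mr_plus_one`. -/
theorem not_hasDetRepr_quadSize_of_odd {n : ℕ} (hn : 3 ≤ n) (hodd : Odd n) :
    ¬ HasDetRepr (perPoly (Fin n) ℂ) (n ^ 2 / 2 + 1) := by
  intro h
  have hle := mr_plus_one hn h
  have hsq : n ^ 2 % 2 = 1 := Nat.odd_iff.mp hodd.pow
  omega

/-- The remaining (pure border-gap) half of the negation line: for infinitely many odd `n`, affine
border membership of `per_n` at the critical size `⌊n²/2⌋+1` forces an exact expression of that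
size ("no border/exact gap for the permanent at the Landsberg–Manivel–Ressayre critical size"). -/
def NoGapOdd : Prop :=
  ∀ n₀ : ℕ, ∃ n ≥ n₀, Odd n ∧ (InBorder n (n ^ 2 / 2 + 1) → HasDetRepr (perPoly (Fin n) ℂ) (n ^ 2 / 2 + 1))

/-- **Composition of the negation line (kernel-checked modulo its two inputs):** `MR + 1` and
`NoGapOdd` give `¬ InBorder(n, ⌊n²/2⌋+1)` for infinitely many (odd) `n`, which refutes the crux
modulo the named fact `skodaBrownawellDegreeBound` by the landed
`not_refutationBarrier_of_io_notInBorder` (p105398). -/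
theorem not_refutationBarrier_of_noGapOdd
    (hSB : ∀ n m : ℕ, skodaBrownawellDegreeBound (σ := Unk n m) (ι := (Fin n × Fin n) →₀ ℕ))
    (hMR1 : ∀ n m : ℕ, 3 ≤ n → HasDetRepr (perPoly (Fin n) ℂ) m → n ^ 2 + 2 ≤ 2 * m)
    (hGap : NoGapOdd) : ¬ RefutationBarrier := by
  apply not_refutationBarrier_of_io_notInBorder hSB
  intro n₀
  obtain ⟨n, hn, hodd, himp⟩ := hGap (max n₀ 3)
  refine ⟨n, le_trans (le_max_left _ _) hn, fun hb => ?_⟩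
  have h3 : 3 ≤ n := le_trans (le_max_right _ _) hn
  have hle := hMR1 n _ h3 (himp hb)
  have hsq : n ^ 2 % 2 = 1 := Nat.odd_iff.mp hodd.pow
  omega

/-! ## Card 2: balanced singular limits (Kempf–Ness location of border-minus-exact) -/

/-- The `t`-th matrix of a tuple of unknowns `W` (`t = none`: the constant matrix `A₀`;
`t = some e`: the coefficient matrix `A_e`). [folklore] -/
def matOf (n m : ℕ) (W : Unk n m → ℂ) (t : Option (Fin n × Fin n)) : Matrix (Fin m) (Fin m) ℂ :=
  Matrix.of fun i j => W (t, (i, j))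

/-- BALANCED (operator-scaled, Kempf–Ness critical) tuple: `Σ_t W_t W_tᴴ = α·1 = Σ_t W_tᴴ W_t`.
[folklore] -/
def Balanced (n m : ℕ) (W : Unk n m → ℂ) : Prop :=
  ∃ α : ℝ, (∑ t, matOf n m W t * (matOf n m W t).conjTranspose = (α : ℂ) • (1 : Matrix (Fin m) (Fin m) ℂ)) ∧
    (∑ t, (matOf n m W t).conjTranspose * matOf n m W t = (α : ℂ) • (1 : Matrix (Fin m) (Fin m) ℂ))

/-- SINGULAR tuple: the determinant of the pencil `W₀ + Σ_e x_e W_e` vanishes identically in `x`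
(the span of the tuple is a singular matrix space). [folklore] -/
def SingularTuple (n m : ℕ) (W : Unk n m → ℂ) : Prop :=
  ∀ μ, MvPolynomial.eval W (((pencil n m).det).coeff μ) = 0

/-- **First lemma of card `balanced-singular-limits` (border-gap dichotomy).** If `per_n` is in the
affine border at size `m` then EITHER it has an exact size-`m` expression, OR there is a norm-one
BALANCED tuple spanning a SINGULAR matrix space — the normalised limit of Kempf–Ness representatives
of a diverging approximating sequence (`det∘pencil` is `SL_m × SL_m`-invariant; minimal vectors of
the closed orbit in each orbit closure exist and are balanced by the first-order condition; bounded
minimal norms give an exact solution by compactness, unbounded ones a singular balanced limit). -/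
theorem border_gap_dichotomy (n m : ℕ) (hb : InBorder n m) :
    HasDetRepr (perPoly (Fin n) ℂ) m ∨
      ∃ W : Unk n m → ℂ, ‖W‖ = 1 ∧ Balanced n m W ∧ SingularTuple n m W := by
  sorry

/-- **Balanced ⟹ full non-commutative rank** (Gurvits / King: a nonzero doubly-stochastic tuple has
no shrunk subspace), so the singular limit space of `border_gap_dichotomy` is an EDMONDS-GAP space
(commutative rank `< m =` non-commutative rank): the only directions along which the border can
exceed the exact image. -/
theorem ncFullRank_of_balanced (n m : ℕ) (W : Unk n m → ℂ) (hW : W ≠ 0) (hb : Balanced n m W) :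
    ∀ U : Submodule ℂ (Fin m → ℂ),
      Module.finrank ℂ U ≤ Module.finrank ℂ ↥(⨆ t, U.map (Matrix.toLin' (matOf n m W t))) := by
  sorry

end Summit.ValiantsHypothesis.ValiantsHypothesis.Cruxes.RefutationBarrier.Ideator5

end
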